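import Literature.Probability.LatticeModels.DiscreteRectSeparation
import Literature.Probability.LatticeModels.RandomClusterFKG
import Literature.Probability.LatticeModels.DiscreteRWPartitionFunction
import HarnessLib

/-!
# Crossing probabilities in topological rectangles (CDH16 Thm. 1.1): proof bricks

Sibling proof file of `Literature.Probability.LatticeModels.FKIsingTopologicalRectangleCrossing`, which
states D. Chelkak, H. Duminil-Copin, C. Hongler, *Crossing probabilities in topological rectangles for the
critical planar FK-Ising model*, Electron. J. Probab. 21 (2016), no. 5 (arXiv:1312.7785), Thm. 1.1 (with
Rem. 2.2) as the named fact `fkIsing_topologicalRectangle_crossingBounds`. That theorem is NOT proved in the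
tree: its printed proof (CDH16 §4) rests on Chelkak's toolbox (CDH16 Thms. 3.4, 3.7, 3.9 = Chelkak 2016),
the Chelkak–Smirnov two-observable representation of alternating-boundary-condition crossing probabilities
(Prop. 4.1), the DHN11 point-to-arc observable bound (Prop. 4.3), separator surgery and planar duality on
general discrete domains, none of which the tree has yet. This file collects the elementary bricks of that
proof as they get formalised, starting with the technical **Lemma 4.7** behind the second-moment bound of
Prop. 4.6 (`sum_sum_mul_div_sqrt_le_four`, proved with the constant `4` in place of the printed sharp
`8/3`, by the one-dimensional telescoping bound `sum_div_sqrt_partialSum_le` instead of the comparison with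
`∬ |x-y|^{-1/2}`), followed by the combinatorial topology of the presentations
`DiscreteRect.IsRect E d₀ n` of discrete topological rectangles (CDH16 §2.1: "we always assume that
`G` is connected and simply connected"): boundary tracing moves along edges of `E`
(`DiscreteRect.succ_reachable`), so the single boundary orbit of a presentation connects the whole
domain (`DiscreteRect.IsRect.reachable`, `DiscreteRect.IsRect.connected`), the four arcs are nonempty
finite sets of boundary vertices, and `ℓ_Ω[(ab),(cd)] < ∞` (`DiscreteRect.IsRect.innerResistance_lt_top`);
and the separation lemma of `DiscreteRectSeparation.lean` transferred to walks of subgraphs of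
`DiscreteRect.graph E` (`DiscreteRect.IsRect.exists_mem_support_inter_subgraph`); then the
**second-moment step** of the proof of Thm. 1.1 (i) (CDH16 §4.3: with the weighted pair count
`N = Σ_{u ∈ (ab)} Σ_{v ∈ (cd)} φ[u ↔ v] 𝟙_{u ↔ v}` of (4.1), "`φ[(ab) ↔ (cd)] = φ[N > 0] ≥ φ[N]²/φ[N²]`"),
proved for every finite random-cluster measure (`rcMeasure_sq_sum_openConnIn_le_openCrossing_mul`,
`rcMeasure_sq_sum_sq_openConnIn_le_openCrossing_mul`) and specialised to CDH16's measures
`DiscreteRect.fkMeasure` (`DiscreteRect.fkMeasure_sq_sum_sq_openConnIn_le_openCrossing_mul`); and the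
**finiteness of the random-walk partition function** `Z_Ω[x,y]` of CDH16 §3.1
(`DiscreteRWPartitionFunction.lean`, the currency of the analytic inputs Thms. 3.4, 3.7, 3.9, Props. 4.1,
4.3 of the printed proof): the path sum is summed by length (`DiscreteRect.rwZ_eq_tsum_sum`), the level sums
obey the one-step recursion of the killed walk (`DiscreteRect.sum_walkWeight_finsetWalkLength_succ`, operator
`DiscreteRect.stepOp`, the one auxiliary definition of this file), the walk dies at the boundary with
probability `≥ w_ext/(3 + w_ext)` and reaches the boundary from anywhere (`exists_isExtDart_east`), whence
geometric decay (`DiscreteRect.stepOp_iterate_one_le_pow`) and `Z_Ω[x,y] < ∞`, `Z_Ω[X,Y] < ∞`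
(`DiscreteRect.rwZ_lt_top`, `DiscreteRect.rwZSets_lt_top`, `DiscreteRect.IsRect.rwZSets_arcVerts_lt_top`).
No named facts.

## References
* [ChelkakDuminilCopinHongler2016] D. Chelkak, H. Duminil-Copin, C. Hongler, EJP 21 (2016) no. 5, §4.2,
  Lemma 4.7 and the proof of Prop. 4.6; §4.1 eq. (4.1) and §4.3 (proof of Thm. 1.1 (i), second-moment step).
-/

noncomputable section

namespace Literature.Probability.LatticeModels

/-! ### Towards the printed proof: the technical Lemma 4.7 of CDH16 (second-moment bookkeeping)

The proof of Thm. 1.1 (i) in CDH16 §4 is a second-moment estimate for the number `N` of pairs of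
boundary vertices `u ∈ (ab)`, `v ∈ (cd)` joined by an open path (Prop. 4.6), and the double sum over
`u, v ∈ (ab)` arising there is controlled by the elementary Lemma 4.7: for positive reals
`x₁, …, xₙ` and `X_{km} := Σ_{s = min(k,m)}^{max(k,m)} x_s`,
`Σ_{k,m} x_k x_m / X_{km}^{1/2} ≤ (8/3) (Σ_s x_s)^{3/2}` (printed proof: comparison with
`∬_{[0,t]²} |x - y|^{-1/2} dx dy = (8/3) t^{3/2}`). It is proved below with the constant `4` in place of
`8/3` — all that the `≲` of Prop. 4.6 uses — by a one-dimensional telescoping bound on each side of the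
diagonal (`sum_div_sqrt_partialSum_le`: `Σ_j y_j / (y_0 + ⋯ + y_j)^{1/2} ≤ 2 (Σ_j y_j)^{1/2}`, from
`y / √P ≤ 2 (√P - √(P - y))`), which avoids improper integrals. -/

section Lemma47

open Finset

/-- **One-dimensional telescoping bound**: for nonnegative reals `y₀, …, y_{L-1}`,
`Σ_{j < L} y_j / √(y₀ + ⋯ + y_j) ≤ 2 √(y₀ + ⋯ + y_{L-1})`, because
`y_j / √P_{j+1} ≤ 2 (√P_{j+1} - √P_j)` for the partial sums `P_j = Σ_{i<j} y_i` (a lower Riemann sum of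
the decreasing function `P ↦ P^{-1/2}`); terms with a vanishing partial sum are `0` by `x / 0 = 0` and
contribute nothing. [folklore] -/
theorem sum_div_sqrt_partialSum_le (y : ℕ → ℝ) (hy : ∀ i, 0 ≤ y i) (L : ℕ) :
    ∑ j ∈ range L, y j / Real.sqrt (∑ i ∈ range (j + 1), y i)
      ≤ 2 * Real.sqrt (∑ i ∈ range L, y i) := by
  have key : ∀ j, y j / Real.sqrt (∑ i ∈ range (j + 1), y i) ≤
      2 * (Real.sqrt (∑ i ∈ range (j + 1), y i) - Real.sqrt (∑ i ∈ range j, y i)) := by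
    intro j
    have hP : 0 ≤ ∑ i ∈ range j, y i := sum_nonneg fun i _ ↦ hy i
    rw [sum_range_succ]
    set P := ∑ i ∈ range j, y i with hPdef
    rcases (add_nonneg hP (hy j)).eq_or_lt with h0 | hpos
    · have hyj : y j = 0 := by linarith [hy j]
      rw [hyj, zero_div, add_zero, sub_self, mul_zero]
    · set s := Real.sqrt (P + y j) with hsdef
      have hs : 0 < s := Real.sqrt_pos.2 hpos
      have hsP : Real.sqrt P ≤ s := Real.sqrt_le_sqrt (by linarith [hy j])
      have hy' : y j = (s - Real.sqrt P) * (s + Real.sqrt P) := by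
        have h1 : s ^ 2 = P + y j := Real.sq_sqrt hpos.le
        have h2 : Real.sqrt P ^ 2 = P := Real.sq_sqrt hP
        nlinarith [h1, h2]
      rw [div_le_iff₀ hs, hy']
      nlinarith [Real.sqrt_nonneg P]
  calc ∑ j ∈ range L, y j / Real.sqrt (∑ i ∈ range (j + 1), y i)
      ≤ ∑ j ∈ range L, 2 * (Real.sqrt (∑ i ∈ range (j + 1), y i) -
          Real.sqrt (∑ i ∈ range j, y i)) := sum_le_sum fun j _ ↦ key j
    _ = 2 * Real.sqrt (∑ i ∈ range L, y i) := by
        rw [← mul_sum, sum_range_sub (fun j ↦ Real.sqrt (∑ i ∈ range j, y i))]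
        simp

/-- Reindexing an interval sum from its left end: `Σ_{s ∈ [k, k+j]} f s = Σ_{i ≤ j} f (k + i)`.
[folklore] -/
theorem sum_Icc_eq_sum_range_add (f : ℕ → ℝ) (k j : ℕ) :
    ∑ s ∈ Icc k (k + j), f s = ∑ i ∈ range (j + 1), f (k + i) := by
  rw [← Finset.Ico_add_one_right_eq_Icc, sum_Ico_eq_sum_range]
  have : k + j + 1 - k = j + 1 := by omega
  rw [this]

/-- Reindexing an interval sum from its right end: `Σ_{s ∈ [k-j, k]} f s = Σ_{i ≤ j} f (k - i)` for
`j ≤ k`. [folklore] -/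
theorem sum_Icc_eq_sum_range_sub (f : ℕ → ℝ) {k j : ℕ} (hj : j ≤ k) :
    ∑ s ∈ Icc (k - j) k, f s = ∑ i ∈ range (j + 1), f (k - i) := by
  rw [range_eq_Ico, sum_Ico_reflect _ 0 (by omega : j + 1 ≤ k + 1),
    ← Finset.Ico_add_one_right_eq_Icc]
  have h1 : k + 1 - (j + 1) = k - j := by omega
  have h2 : k + 1 - 0 = k + 1 := by omega
  rw [h1, h2]

/-- **CDH16, Lemma 4.7** (with the constant `4` in place of the printed sharp `8/3`): for nonnegative
reals `x₀, …, x_{n-1}` and `X_{km} := Σ_{s = min(k,m)}^{max(k,m)} x_s`,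
`Σ_{k,m < n} x_k x_m / X_{km}^{1/2} ≤ 4 (Σ_s x_s)^{3/2}` (here `(Σ x) · √(Σ x)`). Printed: "Let
`x₁, …, xₙ > 0` and `X_{km} = X_{mk} := Σ_{s=k}^m x_s` for `1 ≤ k ≤ m ≤ n`. Then
`Σ_{k,m=1}^n x_k x_m / X_{km}^{1/2} ≤ (8/3) [Σ_{s=1}^n x_s]^{3/2}`", proved there by comparison with
the double integral `∬ |x-y|^{-1/2}`; the weaker constant suffices for its only use (the `≲` in the proof
of Prop. 4.6) and follows from `sum_div_sqrt_partialSum_le` on each side of the diagonal: for fixed `k`,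
`Σ_{m ≥ k} x_m / X_{km}^{1/2} ≤ 2 √(Σ x)` and `Σ_{m < k} x_m / X_{km}^{1/2} ≤ 2 √(Σ x)`. Terms with
`X_{km} = 0` vanish (`x / 0 = 0`, and then `x_k = 0` anyway).
[cite: ChelkakDuminilCopinHongler2016, Lemma 4.7] -/
theorem sum_sum_mul_div_sqrt_le_four (x : ℕ → ℝ) (hx : ∀ i, 0 ≤ x i) (n : ℕ) :
    ∑ k ∈ range n, ∑ m ∈ range n,
        x k * x m / Real.sqrt (∑ s ∈ Icc (min k m) (max k m), x s)
      ≤ 4 * ((∑ s ∈ range n, x s) * Real.sqrt (∑ s ∈ range n, x s)) := by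
  set T := ∑ s ∈ range n, x s with hT
  -- inner bound: for `k < n`, `∑_m x m / √X(k,m) ≤ 4 √T`
  have inner : ∀ k < n, ∑ m ∈ range n, x m / Real.sqrt (∑ s ∈ Icc (min k m) (max k m), x s)
      ≤ 4 * Real.sqrt T := by
    intro k hk
    rw [← sum_range_add_sum_Ico _ hk.le]
    -- the part `m < k`, reflected: `m = k - (j + 1)`
    have hlow : ∑ m ∈ range k, x m / Real.sqrt (∑ s ∈ Icc (min k m) (max k m), x s)
        ≤ 2 * Real.sqrt T := by
      set y : ℕ → ℝ := fun i ↦ x (k - i) with hy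
      have hy0 : ∀ i, 0 ≤ y i := fun i ↦ hx _
      have hrefl : ∑ m ∈ range k, x m / Real.sqrt (∑ s ∈ Icc (min k m) (max k m), x s) =
          ∑ j ∈ range k, y (j + 1) / Real.sqrt (∑ i ∈ range (j + 2), y i) := by
        rw [← sum_range_reflect (fun m ↦ x m / Real.sqrt (∑ s ∈ Icc (min k m) (max k m), x s)) k]
        refine sum_congr rfl fun j hj ↦ ?_
        have hj' := mem_range.1 hj
        have hmin : min k (k - 1 - j) = k - 1 - j := min_eq_right (by omega)
        have hmax : max k (k - 1 - j) = k := max_eq_left (by omega)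
        rw [hmin, hmax, show k - 1 - j = k - (j + 1) by omega,
          sum_Icc_eq_sum_range_sub x (by omega : j + 1 ≤ k)]
      rw [hrefl]
      have h1 : ∑ j ∈ range k, y (j + 1) / Real.sqrt (∑ i ∈ range (j + 2), y i)
          ≤ ∑ j ∈ range (k + 1), y j / Real.sqrt (∑ i ∈ range (j + 1), y i) := by
        rw [sum_range_succ' (fun j ↦ y j / Real.sqrt (∑ i ∈ range (j + 1), y i))]
        have : 0 ≤ y 0 / Real.sqrt (∑ i ∈ range (0 + 1), y i) :=
          div_nonneg (hy0 0) (Real.sqrt_nonneg _)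
        linarith
      refine h1.trans ((sum_div_sqrt_partialSum_le y hy0 (k + 1)).trans ?_)
      gcongr
      calc ∑ i ∈ range (k + 1), y i = ∑ s ∈ range (k + 1), x s := by
            rw [← sum_Icc_eq_sum_range_sub x le_rfl, Nat.sub_self, range_eq_Ico,
              Finset.Ico_add_one_right_eq_Icc]
        _ ≤ T := by
            rw [hT]
            exact sum_le_sum_of_subset_of_nonneg (range_subset_range.2 hk) fun i _ _ ↦ hx i
    -- the part `k ≤ m < n`, shifted: `m = k + j`
    have hhigh : ∑ m ∈ Ico k n, x m / Real.sqrt (∑ s ∈ Icc (min k m) (max k m), x s)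
        ≤ 2 * Real.sqrt T := by
      set y : ℕ → ℝ := fun i ↦ x (k + i) with hy
      have hy0 : ∀ i, 0 ≤ y i := fun i ↦ hx _
      have hshift : ∑ m ∈ Ico k n, x m / Real.sqrt (∑ s ∈ Icc (min k m) (max k m), x s) =
          ∑ j ∈ range (n - k), y j / Real.sqrt (∑ i ∈ range (j + 1), y i) := by
        rw [sum_Ico_eq_sum_range]
        refine sum_congr rfl fun j _ ↦ ?_
        have hmin : min k (k + j) = k := min_eq_left (by omega)
        have hmax : max k (k + j) = k + j := max_eq_right (by omega)
        rw [hmin, hmax, sum_Icc_eq_sum_range_add]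
      rw [hshift]
      refine (sum_div_sqrt_partialSum_le y hy0 (n - k)).trans ?_
      gcongr
      calc ∑ i ∈ range (n - k), y i = ∑ m ∈ Ico k n, x m := by
            rw [sum_Ico_eq_sum_range]
        _ ≤ T := by
            rw [hT, range_eq_Ico]
            exact sum_le_sum_of_subset_of_nonneg (Ico_subset_Ico (Nat.zero_le _) le_rfl)
              fun i _ _ ↦ hx i
    linarith
  -- assemble: `S = Σ_k x_k (Σ_m …) ≤ Σ_k x_k · 4 √T = 4 T √T`
  calc ∑ k ∈ range n, ∑ m ∈ range n, x k * x m / Real.sqrt (∑ s ∈ Icc (min k m) (max k m), x s)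
      = ∑ k ∈ range n, x k * ∑ m ∈ range n,
          x m / Real.sqrt (∑ s ∈ Icc (min k m) (max k m), x s) := by
        refine sum_congr rfl fun k _ ↦ ?_
        rw [mul_sum]
        refine sum_congr rfl fun m _ ↦ ?_
        ring
    _ ≤ ∑ k ∈ range n, x k * (4 * Real.sqrt T) :=
        sum_le_sum fun k hk ↦ mul_le_mul_of_nonneg_left (inner k (mem_range.1 hk)) (hx k)
    _ = 4 * (T * Real.sqrt T) := by rw [← sum_mul]; ring

end Lemma47

/-! ### Connectivity and arcs of a presented discrete topological rectangle

CDH16 §2.1 take discrete domains to be connected (and simply connected) subgraphs of `ℤ²`; in the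
tree's presentation `DiscreteRect.IsRect E d₀ n` both properties are encoded by the single
boundary-tracing orbit running through all external darts. Connectivity is recovered here: the
successor dart's base vertex is joined to the dart's base vertex by at most three edges of `E`
(the case hypotheses of `DiscreteRect.succ`), and from any vertex of the domain the row of edges in
direction `e₀` leads, inside `⟨E⟩`, to a vertex with a missing east edge, i.e. to the base of an
external dart, which the orbit visits. -/

section IsRectAPI

namespace DiscreteRect

open SimpleGraph

variable {E : Finset (Sym2 (Site 2))} {d₀ : Site 2 × Fin 4} {n : Fin 4 → ℕ}

/-- An edge `{x, x + v}` of `E` (`v ≠ 0`) is an adjacency of `⟨E⟩`. [folklore] -/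
theorem fromEdgeSet_adj_of_mem {x v : Site 2} (hv : v ≠ 0) (h : s(x, x + v) ∈ E) :
    (fromEdgeSet (↑E : Set (Sym2 (Site 2)))).Adj x (x + v) := by
  rw [fromEdgeSet_adj]
  refine ⟨h, fun heq ↦ hv ?_⟩
  simpa using heq.symm

/-- **Boundary tracing moves along edges of the domain**: the base vertex of the successor dart is
joined to the base vertex of the dart by a path of `⟨E⟩` (of length `0, 1, 2, 3` in the four cases of
`succ`, along the edges whose presence is the case hypothesis). [folklore] -/
theorem succ_reachable (d : Site 2 × Fin 4) :
    (fromEdgeSet (↑E : Set (Sym2 (Site 2)))).Reachable d.1 (succ E d).1 := by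
  obtain ⟨x, k⟩ := d
  unfold DiscreteRect.succ
  dsimp only
  split_ifs with h1 h2 h3
  · exact (((fromEdgeSet_adj_of_mem (dir_ne_zero _) h1).reachable.trans
      (fromEdgeSet_adj_of_mem (dir_ne_zero _) h2).reachable).trans
      (fromEdgeSet_adj_of_mem (dir_ne_zero _) h3).reachable)
  · exact (fromEdgeSet_adj_of_mem (dir_ne_zero _) h1).reachable.trans
      (fromEdgeSet_adj_of_mem (dir_ne_zero _) h2).reachable
  · exact (fromEdgeSet_adj_of_mem (dir_ne_zero _) h1).reachable
  · rfl

/-- Every dart of a boundary-tracing orbit has its base vertex in the `⟨E⟩`-component of the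
base vertex of the initial dart. [folklore] -/
theorem iterate_succ_reachable (d : Site 2 × Fin 4) (i : ℕ) :
    (fromEdgeSet (↑E : Set (Sym2 (Site 2)))).Reachable d.1 ((DiscreteRect.succ E)^[i] d).1 := by
  induction i with
  | zero => rfl
  | succ i ih =>
    rw [Function.iterate_succ_apply']
    exact ih.trans (succ_reachable _)

/-- Vertices of `⟨E⟩` reachable from a vertex of the domain are vertices of the domain. [folklore] -/
theorem mem_verts_of_walk {x y : Site 2} (p : (fromEdgeSet (↑E : Set (Sym2 (Site 2)))).Walk x y)
    (hx : x ∈ verts E) : y ∈ verts E := by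
  induction p with
  | nil => exact hx
  | cons h q ih => exact ih (mem_verts_of_mem ((fromEdgeSet_adj _).1 h).1)

/-- **Walking east to the boundary**: from every vertex of the domain, following the edges of `E`
in the direction `e₀` one reaches (inside `⟨E⟩`) a vertex whose east edge is missing, i.e. the
base of an external dart of direction `0` (the domain is finite). [folklore] -/
theorem exists_isExtDart_east {x : Site 2} (hx : x ∈ verts E) :
    ∃ t : ℕ, IsExtDart E (x + (t : ℤ) • dir 0, 0) ∧
      (fromEdgeSet (↑E : Set (Sym2 (Site 2)))).Reachable x (x + (t : ℤ) • dir 0) := by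
  classical
  have hfin : ∃ t : ℕ, s(x + (t : ℤ) • dir 0, x + (t : ℤ) • dir 0 + dir 0) ∉ E := by
    by_contra hcon
    push Not at hcon
    have hmem : ∀ t : ℕ, x + (t : ℤ) • dir 0 ∈ (↑(verts E) : Set (Site 2)) := by
      intro t
      cases t with
      | zero => simpa using hx
      | succ t =>
        have := mem_verts_of_mem (hcon t)
        rw [Finset.mem_coe]
        convert this using 1
        push_cast
        rw [add_smul, one_smul, add_assoc]
    have hinj : Function.Injective (fun t : ℕ ↦ x + (t : ℤ) • dir 0) := by
      intro a b hab
      have := congrFun hab 0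
      simpa [dir] using this
    exact Set.infinite_of_injective_forall_mem hinj hmem (Finset.finite_toSet _)
  refine ⟨Nat.find hfin, ⟨?_, Nat.find_spec hfin⟩, ?_⟩
  · -- reachability along the row, by induction up to the first missing east edge
    suffices hreach : ∀ t ≤ Nat.find hfin,
        (fromEdgeSet (↑E : Set (Sym2 (Site 2)))).Reachable x (x + (t : ℤ) • dir 0) by
      obtain ⟨p⟩ := hreach _ le_rfl
      exact mem_verts_of_walk p hx
    intro t ht
    induction t with
    | zero => simp
    | succ t ih =>
      have hlt : t < Nat.find hfin := Nat.lt_of_succ_le ht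
      have hmemE : s(x + (t : ℤ) • dir 0, x + (t : ℤ) • dir 0 + dir 0) ∈ E := by
        have := Nat.find_min hfin hlt
        simpa using this
      have hadj := fromEdgeSet_adj_of_mem (dir_ne_zero 0) hmemE
      have heq : x + (t : ℤ) • dir 0 + dir 0 = x + ((t + 1 : ℕ) : ℤ) • dir 0 := by
        push_cast
        rw [add_smul, one_smul, add_assoc]
      rw [heq] at hadj
      exact (ih hlt.le).trans hadj.reachable
  · suffices hreach : ∀ t ≤ Nat.find hfin,
        (fromEdgeSet (↑E : Set (Sym2 (Site 2)))).Reachable x (x + (t : ℤ) • dir 0) from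
      hreach _ le_rfl
    intro t ht
    induction t with
    | zero => simp
    | succ t ih =>
      have hlt : t < Nat.find hfin := Nat.lt_of_succ_le ht
      have hmemE : s(x + (t : ℤ) • dir 0, x + (t : ℤ) • dir 0 + dir 0) ∈ E := by
        have := Nat.find_min hfin hlt
        simpa using this
      have hadj := fromEdgeSet_adj_of_mem (dir_ne_zero 0) hmemE
      have heq : x + (t : ℤ) • dir 0 + dir 0 = x + ((t + 1 : ℕ) : ℤ) • dir 0 := by
        push_cast
        rw [add_smul, one_smul, add_assoc]
      rw [heq] at hadj
      exact (ih hlt.le).trans hadj.reachable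

/-- **A discrete topological rectangle is connected** (CDH16 §2.1: "we always assume that `G` is
connected"): in a presentation `IsRect E d₀ n` every vertex of the domain is joined inside `⟨E⟩` to
the base vertex of the first dart — walk east to an external dart, which lies on the single
boundary-tracing orbit, along which consecutive base vertices are joined by edges of `E`.
[cite: ChelkakDuminilCopinHongler2016, §2.1] -/
theorem IsRect.reachable_of_mem_verts (h : IsRect E d₀ n) {x : Site 2} (hx : x ∈ verts E) :
    (fromEdgeSet (↑E : Set (Sym2 (Site 2)))).Reachable d₀.1 x := by
  obtain ⟨t, hdart, hreach⟩ := exists_isExtDart_east hx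
  obtain ⟨i, -, hi⟩ := h.cover _ hdart
  have := iterate_succ_reachable (E := E) d₀ i
  rw [hi] at this
  exact this.trans hreach.symm

/-- Any two vertices of a discrete topological rectangle are joined by a path of `⟨E⟩`.
[cite: ChelkakDuminilCopinHongler2016, §2.1] -/
theorem IsRect.reachable (h : IsRect E d₀ n) {x y : Site 2} (hx : x ∈ verts E) (hy : y ∈ verts E) :
    (fromEdgeSet (↑E : Set (Sym2 (Site 2)))).Reachable x y :=
  (h.reachable_of_mem_verts hx).symm.trans (h.reachable_of_mem_verts hy)

/-- Transfer of walks of `⟨E⟩` between vertices of the domain to the graph `DiscreteRect.graph E`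
on the vertex type (all intermediate vertices are endpoints of edges of `E`). [folklore] -/
theorem graph_reachable_of_walk {x y : Site 2} (p : (fromEdgeSet (↑E : Set (Sym2 (Site 2)))).Walk x y)
    (hx : x ∈ verts E) (hy : y ∈ verts E) :
    (graph E).Reachable ⟨x, hx⟩ ⟨y, hy⟩ := by
  induction p with
  | nil => rfl
  | cons h q ih =>
    rename_i a b c
    have hb : b ∈ verts E := mem_verts_of_mem ((fromEdgeSet_adj _).1 h).1
    have hadj : (graph E).Adj ⟨a, hx⟩ ⟨b, hb⟩ := by
      simpa [graph] using h
    exact hadj.reachable.trans (ih hb hy)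

/-- **`DiscreteRect.graph E` is preconnected** for a presented rectangle.
[cite: ChelkakDuminilCopinHongler2016, §2.1] -/
theorem IsRect.preconnected (h : IsRect E d₀ n) : (graph E).Preconnected := by
  rintro ⟨x, hx⟩ ⟨y, hy⟩
  obtain ⟨p⟩ := h.reachable hx hy
  exact graph_reachable_of_walk p hx hy

/-- **`DiscreteRect.graph E` is connected** for a presented rectangle (nonempty: the base vertex of
the first dart). [cite: ChelkakDuminilCopinHongler2016, §2.1] -/
theorem IsRect.connected (h : IsRect E d₀ n) : (graph E).Connected := by
  haveI : Nonempty ↥((verts E : Finset (Site 2)) : Set (Site 2)) := ⟨⟨d₀.1, h.isExtDart.1⟩⟩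
  exact ⟨h.preconnected⟩

/-- The base vertex of the dart at a position of the `j`-th arc lies in `arcVerts j`. [folklore] -/
theorem fst_iterate_mem_arcVerts {j : Fin 4} {i : ℕ} (h1 : lo n j ≤ i) (h2 : i < lo n j + n j) :
    ((DiscreteRect.succ E)^[i] d₀).1 ∈ arcVerts E d₀ n j :=
  ⟨i, h1, h2, rfl⟩

/-- The arcs consist of boundary vertices. [folklore] -/
theorem arcVerts_subset_bdVerts (h : IsExtDart E d₀) (j : Fin 4) : arcVerts E d₀ n j ⊆ bdVerts E := by
  rintro x ⟨i, -, -, rfl⟩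
  exact ⟨((DiscreteRect.succ E)^[i] d₀).2, h.iterate i⟩

/-- Boundary vertices are vertices of the domain. [folklore] -/
theorem bdVerts_subset_verts : bdVerts E ⊆ (↑(verts E) : Set (Site 2)) := fun _ ⟨_, hk⟩ ↦ hk.1

/-- The arcs of a presented rectangle are vertices of the domain. [folklore] -/
theorem arcVerts_subset_verts (h : IsExtDart E d₀) (j : Fin 4) :
    arcVerts E d₀ n j ⊆ (↑(verts E) : Set (Site 2)) :=
  (arcVerts_subset_bdVerts h j).trans bdVerts_subset_verts

/-- The arcs of a presented rectangle are nonempty (`n j ≥ 1`). [folklore] -/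
theorem IsRect.arcVerts_nonempty (h : IsRect E d₀ n) (j : Fin 4) : (arcVerts E d₀ n j).Nonempty :=
  ⟨_, fst_iterate_mem_arcVerts le_rfl (by have := h.pos j; omega)⟩

/-- The arcs of a presented rectangle are finite sets. [folklore] -/
theorem arcVerts_finite (E : Finset (Sym2 (Site 2))) (d₀ : Site 2 × Fin 4) (n : Fin 4 → ℕ) (j : Fin 4) :
    (arcVerts E d₀ n j).Finite := by
  have : arcVerts E d₀ n j ⊆ (fun i ↦ ((DiscreteRect.succ E)^[i] d₀).1) '' Set.Iio (lo n j + n j) := by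
    rintro x ⟨i, -, hi, rfl⟩
    exact ⟨i, hi, rfl⟩
  exact ((Set.finite_Iio _).image _).subset this

/-- **The four arcs cover the boundary**: every boundary vertex of a presented rectangle carries an
external dart, which lies on the boundary cycle (`IsRect.cover`) at a position of one of the four
arcs. [cite: ChelkakDuminilCopinHongler2016, §2.1] -/
theorem IsRect.exists_mem_arcVerts_of_mem_bdVerts (h : IsRect E d₀ n) {x : Site 2}
    (hx : x ∈ bdVerts E) : ∃ j : Fin 4, x ∈ arcVerts E d₀ n j := by
  obtain ⟨k, hk⟩ := hx
  obtain ⟨i, hi, hix⟩ := h.cover _ hk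
  have hx' : ((DiscreteRect.succ E)^[i] d₀).1 = x := by rw [hix]
  by_cases h0 : i < n 0
  · exact ⟨0, i, Nat.zero_le _, by simpa [lo] using h0, hx'⟩
  by_cases h1 : i < n 0 + n 1
  · exact ⟨1, i, by simp [lo]; omega, by simp [lo]; omega, hx'⟩
  by_cases h2 : i < n 0 + n 1 + n 2
  · exact ⟨2, i, by simp [lo]; omega, by simp [lo]; omega, hx'⟩
  · exact ⟨3, i, by simp [lo]; omega, by simp [lo]; omega, hx'⟩

/-- The boundary of a presented rectangle is the union of its four arcs.
[cite: ChelkakDuminilCopinHongler2016, §2.1] -/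
theorem IsRect.bdVerts_eq_iUnion_arcVerts (h : IsRect E d₀ n) :
    bdVerts E = ⋃ j : Fin 4, arcVerts E d₀ n j := by
  ext x
  simp only [Set.mem_iUnion]
  exact ⟨h.exists_mem_arcVerts_of_mem_bdVerts, fun ⟨j, hj⟩ ↦ arcVerts_subset_bdVerts h.isExtDart j hj⟩

/-- **`ℓ_Ω[(ab),(cd)] < ∞`** for a presented rectangle: the arcs are nonempty and joined by a path of
`⟨E⟩` (series upper bound `effectiveResistance_le_sum_inv`). [cite: ChelkakDuminilCopinHongler2016, §3.3] -/
theorem IsRect.innerResistance_lt_top (h : IsRect E d₀ n) :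
    effectiveResistance (fromEdgeSet (↑E : Set (Sym2 (Site 2)))) 1
      (arcVerts E d₀ n 0) (arcVerts E d₀ n 2) < ⊤ := by
  classical
  obtain ⟨a, ha⟩ := h.arcVerts_nonempty 0
  obtain ⟨z, hz⟩ := h.arcVerts_nonempty 2
  obtain ⟨p⟩ := h.reachable (arcVerts_subset_verts h.isExtDart 0 ha)
    (arcVerts_subset_verts h.isExtDart 2 hz)
  refine (effectiveResistance_le_sum_inv ha hz p.bypass
    (Walk.edges_nodup_of_support_nodup p.bypass_isPath.support_nodup) (fun e _ ↦ by simp)).trans_lt ?_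
  exact ENNReal.sum_lt_top.2 fun e _ ↦ by simp

end DiscreteRect

end IsRectAPI

/-! ### The separation lemma on the vertex type of the domain

`DiscreteRectSeparation.lean` proves that walks of `⟨E⟩` joining the arcs `0` and `2` of a presented
rectangle meet walks joining the arcs `1` and `3` (`DiscreteRect.IsRect.exists_mem_support_inter`).
The FK-Ising measure of the rectangle and its crossing events live on the graph
`DiscreteRect.graph E` on the vertex type of the domain and on its (open) subgraphs; the lemma is
transferred to walks of arbitrary subgraphs of `DiscreteRect.graph E` here — the form in which
CDH16 §4 uses it ("topologically, it must intersect any crossing", proof of Lemma 4.5). -/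

section SeparationSubtype

namespace DiscreteRect

open SimpleGraph

variable {E : Finset (Sym2 (Site 2))} {d₀ : Site 2 × Fin 4} {n : Fin 4 → ℕ}

/-- A walk of a subgraph of `DiscreteRect.graph E` projects to a walk of `⟨E⟩` with the same
vertices. [folklore] -/
theorem exists_walk_fromEdgeSet_of_walk {H : SimpleGraph ↥((verts E : Finset (Site 2)) : Set (Site 2))}
    (hH : H ≤ graph E) {a b : ↥((verts E : Finset (Site 2)) : Set (Site 2))} (P : H.Walk a b) :
    ∃ P' : (fromEdgeSet (↑E : Set (Sym2 (Site 2)))).Walk a.1 b.1,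
      ∀ z ∈ P'.support, ∃ w ∈ P.support, w.1 = z := by
  induction P with
  | nil =>
    refine ⟨Walk.nil, fun z hz ↦ ⟨_, Walk.start_mem_support _, ?_⟩⟩
    rw [Walk.support_nil, List.mem_singleton] at hz
    exact hz.symm
  | cons h q ih =>
    rename_i u v w
    obtain ⟨Q, hQ⟩ := ih
    have hadj : (fromEdgeSet (↑E : Set (Sym2 (Site 2)))).Adj u.1 v.1 := by
      have := hH h
      simpa [graph] using this
    refine ⟨Walk.cons hadj Q, fun z hz ↦ ?_⟩
    rw [Walk.support_cons, List.mem_cons] at hz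
    rcases hz with rfl | hz
    · exact ⟨u, by simp, rfl⟩
    · obtain ⟨w', hw', rfl⟩ := hQ z hz
      exact ⟨w', by simp [hw'], rfl⟩

/-- **Separation lemma on the vertex type** (CDH16 §4: crossings of a topological rectangle
between opposite arcs intersect): for subgraphs `H, H'` of `DiscreteRect.graph E` of a presented
rectangle — e.g. the open subgraphs of two configurations, or the same one — every walk of `H` from
a vertex over the arc `(ab)` to a vertex over `(cd)` shares a vertex with every walk of `H'` from
`(bc)` to `(da)`. [cite: ChelkakDuminilCopinHongler2016, §2.1 and §4 (planarity of discrete domains)] -/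
theorem IsRect.exists_mem_support_inter_subgraph (h : IsRect E d₀ n)
    {H H' : SimpleGraph ↥((verts E : Finset (Site 2)) : Set (Site 2))} (hH : H ≤ graph E)
    (hH' : H' ≤ graph E) {a b c d : ↥((verts E : Finset (Site 2)) : Set (Site 2))}
    (ha : a.1 ∈ arcVerts E d₀ n 0) (hb : b.1 ∈ arcVerts E d₀ n 1) (hc : c.1 ∈ arcVerts E d₀ n 2)
    (hd : d.1 ∈ arcVerts E d₀ n 3) (P₁ : H.Walk a c) (P₂ : H'.Walk b d) :
    ∃ z ∈ P₁.support, z ∈ P₂.support := by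
  obtain ⟨Q₁, hQ₁⟩ := exists_walk_fromEdgeSet_of_walk hH P₁
  obtain ⟨Q₂, hQ₂⟩ := exists_walk_fromEdgeSet_of_walk hH' P₂
  obtain ⟨z, hz₁, hz₂⟩ := h.exists_mem_support_inter_of_mem_arcVerts ha hb hc hd Q₁ Q₂
  obtain ⟨w₁, hw₁, hw₁z⟩ := hQ₁ z hz₁
  obtain ⟨w₂, hw₂, hw₂z⟩ := hQ₂ z hz₂
  have : w₁ = w₂ := Subtype.ext (hw₁z.trans hw₂z.symm)
  exact ⟨w₁, hw₁, this ▸ hw₂⟩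

/-- **Projection of walks of `Ω̄` to `⟨E⟩`**: a walk of the completed graph `extGraph E` projects,
along `inl x ↦ x`, `inr d ↦ d.1` (a step to or from a formal external vertex becomes a stay), to a
walk of `⟨E⟩` between the base vertices of its ends, every vertex of which is the base of a vertex of
the original walk. [folklore] -/
theorem exists_walk_fromEdgeSet_of_extGraph_walk :
    ∀ {u v : Site 2 ⊕ (Site 2 × Fin 4)} (P : (extGraph E).Walk u v),
      ∃ P' : (fromEdgeSet (↑E : Set (Sym2 (Site 2)))).Walk (Sum.elim id Prod.fst u)
          (Sum.elim id Prod.fst v),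
        ∀ z ∈ P'.support, Sum.inl z ∈ P.support ∨ ∃ d : Site 2 × Fin 4, Sum.inr d ∈ P.support ∧ d.1 = z
  | _, _, Walk.nil => ⟨Walk.nil, fun z hz ↦ by
      rename_i u
      rw [Walk.support_nil, List.mem_singleton] at hz
      subst hz
      cases u with
      | inl x => exact Or.inl (by simp)
      | inr d => exact Or.inr ⟨d, by simp, rfl⟩⟩
  | u, _, @Walk.cons _ _ _ w _ hadj q => by
      obtain ⟨Q, hQ⟩ := exists_walk_fromEdgeSet_of_extGraph_walk q
      have lift : ∀ z ∈ Q.support,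
          Sum.inl z ∈ (Walk.cons hadj q).support ∨
            ∃ d : Site 2 × Fin 4, Sum.inr d ∈ (Walk.cons hadj q).support ∧ d.1 = z := by
        intro z hz
        rcases hQ z hz with h1 | ⟨d, hd, hdz⟩
        · exact Or.inl (by simp [h1])
        · exact Or.inr ⟨d, by simp [hd], hdz⟩
      cases u with
      | inl x =>
        cases w with
        | inl y =>
          -- a lattice step
          have hxy : (fromEdgeSet (↑E : Set (Sym2 (Site 2)))).Adj x y :=
            extGraph_adj_inl_inl_iff_fromEdgeSet.1 hadj
          refine ⟨Walk.cons hxy Q, fun z hz ↦ ?_⟩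
          rw [Walk.support_cons, List.mem_cons] at hz
          rcases hz with rfl | hz
          · exact Or.inl (by simp)
          · exact lift z hz
        | inr d =>
          -- out to a formal external vertex: a stay at `x = d.1`
          have hd : d.1 = x := (extGraph_adj_inl_inr.1 hadj).2
          refine ⟨Q.copy hd rfl, fun z hz ↦ ?_⟩
          rw [Walk.support_copy] at hz
          exact lift z hz
      | inr d =>
        cases w with
        | inl y =>
          -- back from a formal external vertex: a stay at `d.1 = y`
          have hd : d.1 = y := (extGraph_adj_inl_inr.1 hadj.symm).2
          refine ⟨Q.copy hd.symm rfl, fun z hz ↦ ?_⟩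
          rw [Walk.support_copy] at hz
          exact lift z hz
        | inr d' => exact absurd hadj extGraph_not_adj_inr_inr

/-- In a walk of `Ω̄` of positive length, the base vertex of every formal external vertex visited is
visited too (external vertices are pendant). [folklore] -/
theorem inl_mem_support_of_inr_mem_support {u v : Site 2 ⊕ (Site 2 × Fin 4)}
    (P : (extGraph E).Walk u v) (hP : P.length ≠ 0) {d : Site 2 × Fin 4}
    (hd : Sum.inr d ∈ P.support) : Sum.inl d.1 ∈ P.support := by
  induction P with
  | nil => simp at hP
  | cons hadj q ih =>
    rename_i a b c
    rw [Walk.support_cons, List.mem_cons] at hd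
    rcases hd with hda | hdq
    · -- `inr d` is the start: the next vertex is its base
      subst hda
      cases b with
      | inl y =>
        have := (extGraph_adj_inl_inr.1 hadj.symm).2
        subst this
        simp
      | inr d' => exact absurd hadj extGraph_not_adj_inr_inr
    · by_cases hq : q.length = 0
      · -- `q` is trivial: `inr d` is the end, reached from its base
        have hbc : b = c := Walk.eq_of_length_eq_zero hq
        subst hbc
        have hnil : q = Walk.nil := by
          cases q with
          | nil => rfl
          | cons _ _ => simp at hq
        subst hnil
        rw [Walk.support_nil, List.mem_singleton] at hdq
        subst hdq
        cases a with
        | inl y =>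
          have := (extGraph_adj_inl_inr.1 hadj).2
          subst this
          simp
        | inr d' => exact absurd hadj extGraph_not_adj_inr_inr
      · have := ih hq hdq
        simp [this]

/-- **Separation lemma in the completed graph `Ω̄`**: walks of `extGraph E` from a formal external
vertex of the external arc `0` to one of the external arc `2` meet walks from the external arc `1`
to the external arc `3` at a lattice vertex (CDH16 §3.3 works with `Ω̄`; this is the form used for
the external arcs `extArc`). [cite: ChelkakDuminilCopinHongler2016, §2.1, §3.3] -/
theorem IsRect.exists_inl_mem_support_inter (h : IsRect E d₀ n) {ia ib ic id : ℕ}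
    (hia : ia < n 0) (hib1 : n 0 ≤ ib) (hib2 : ib < n 0 + n 1) (hic1 : n 0 + n 1 ≤ ic)
    (hic2 : ic < n 0 + n 1 + n 2) (hid1 : n 0 + n 1 + n 2 ≤ id)
    (hid2 : id < n 0 + n 1 + n 2 + n 3)
    (P₁ : (extGraph E).Walk (Sum.inr ((DiscreteRect.succ E)^[ia] d₀))
      (Sum.inr ((DiscreteRect.succ E)^[ic] d₀)))
    (P₂ : (extGraph E).Walk (Sum.inr ((DiscreteRect.succ E)^[ib] d₀))
      (Sum.inr ((DiscreteRect.succ E)^[id] d₀))) :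
    ∃ z : Site 2, Sum.inl z ∈ P₁.support ∧ Sum.inl z ∈ P₂.support := by
  obtain ⟨Q₁, hQ₁⟩ := exists_walk_fromEdgeSet_of_extGraph_walk P₁
  obtain ⟨Q₂, hQ₂⟩ := exists_walk_fromEdgeSet_of_extGraph_walk P₂
  obtain ⟨z, hz₁, hz₂⟩ := h.exists_mem_support_inter hia hib1 hib2 hic1 hic2 hid1 hid2 Q₁ Q₂
  have hl₁ : P₁.length ≠ 0 := by
    intro h0
    have := Walk.eq_of_length_eq_zero h0
    have hne := h.injOn ia ic (by omega) (by omega) (Sum.inr_injective this)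
    omega
  have hl₂ : P₂.length ≠ 0 := by
    intro h0
    have := Walk.eq_of_length_eq_zero h0
    have hne := h.injOn ib id (by omega) (by omega) (Sum.inr_injective this)
    omega
  refine ⟨z, ?_, ?_⟩
  · rcases hQ₁ z hz₁ with h1 | ⟨d, hd, rfl⟩
    · exact h1
    · exact inl_mem_support_of_inr_mem_support P₁ hl₁ hd
  · rcases hQ₂ z hz₂ with h2 | ⟨d, hd, rfl⟩
    · exact h2
    · exact inl_mem_support_of_inr_mem_support P₂ hl₂ hd

end DiscreteRect

end SeparationSubtype

/-! ### CDH16 §4.3: the second-moment step of the proof of Thm. 1.1 (i)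

"The Cauchy–Schwarz inequality and Corollary 4.4 give
`φ^∅_Ω[(ab) ↔ (cd)] = φ^∅_Ω[N > 0] ≥ φ^∅_Ω[N]² / φ^∅_Ω[N²]`" for the weighted pair count
`N := Σ_{u ∈ (ab)} Σ_{v ∈ (cd)} φ^∅_Ω[u ↔ v] 𝟙_{u ↔ v}` of (4.1), whose moments are
`φ[N] = Σ_{u,v} φ[u ↔ v]²` and `φ[N²] = Σ_{u,v,u',v'} φ[u ↔ v] φ[u' ↔ v'] φ[u ↔ v, u' ↔ v']` (proof of
Prop. 4.6). Everything here holds for the random-cluster measure of an arbitrary finite graph with an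
arbitrary wired set, arbitrary finite vertex sets `A`, `C` in place of the arcs, and arbitrary nonnegative
weights; the measure being an explicit finite sum of Dirac masses (`rcMeasure_real_apply`), the proof is the
finite Cauchy–Schwarz inequality `(Σ_ω π_ω N_ω)² ≤ (Σ_{ω ∈ A↔C} π_ω)(Σ_ω π_ω N_ω²)` for `N` vanishing off the
crossing event. -/

section SecondMomentMethod

open MeasureTheory Finset Literature.Probability.Percolation

/-- A connection between `u ∈ A` and `v ∈ C` is a crossing from `A` to `C`. [folklore] -/
theorem openConnIn_subset_openCrossing {V : Type*} {S A C : Set V} {u v : V} (hu : u ∈ A)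
    (hv : v ∈ C) : (openConnIn S u v : Set (BondConfig V)) ⊆ openCrossing S A C :=
  fun _ hω ↦ ⟨u, hu, v, hv, hω⟩

variable {V : Type*} [Fintype V] [DecidableEq V] (G : SimpleGraph V) [DecidableRel G.Adj]

/-- **The second-moment method for crossings** (CDH16 §4.3, proof of Thm. 1.1 (i): with
`N := Σ_{u ∈ (ab)} Σ_{v ∈ (cd)} φ[u ↔ v] 𝟙_{u ↔ v}`, "the Cauchy–Schwarz inequality … give[s]
`φ[(ab) ↔ (cd)] = φ[N > 0] ≥ φ[N]² / φ[N²]`"), for the random-cluster measure `φ = φ^B_{G,p,q}` of any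
finite graph, any two finite vertex sets `A`, `C` and any nonnegative weights `c u v`: writing
`N_c := Σ_{u ∈ A} Σ_{v ∈ C} c_{uv} 𝟙_{u ↔ v}`, one has `φ[N_c]² ≤ φ[A ↔ C] · φ[N_c²]`, i.e.
`(Σ_{u,v} c_{uv} φ[u ↔ v])² ≤ φ[A ↔ C] · Σ_{u,v,u',v'} c_{uv} c_{u'v'} φ[u ↔ v, u' ↔ v']`
(Cauchy–Schwarz for `N_c = N_c · 𝟙_{A ↔ C}`). [cite: ChelkakDuminilCopinHongler2016, §4.3, proof of Thm. 1.1 (i)] -/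
theorem rcMeasure_sq_sum_openConnIn_le_openCrossing_mul {p q : ℝ} (hp : p ∈ Set.Icc (0 : ℝ) 1)
    (hq : 0 < q) (B : Set V) (A C : Finset V) (c : V → V → ℝ) (hc : ∀ u v, 0 ≤ c u v) :
    (∑ u ∈ A, ∑ v ∈ C, c u v * (rcMeasure G p q B).real (openConnIn Set.univ u v)) ^ 2 ≤
      (rcMeasure G p q B).real (openCrossing Set.univ (↑A : Set V) ↑C) *
        ∑ u ∈ A, ∑ v ∈ C, ∑ u' ∈ A, ∑ v' ∈ C, c u v * c u' v' *
          (rcMeasure G p q B).real (openConnIn Set.univ u v ∩ openConnIn Set.univ u' v') := by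
  classical
  set μ := rcMeasure G p q B with hμ
  set P := G.edgeFinset.powerset with hP
  set π : Finset (Sym2 V) → ℝ := fun ω ↦ rcWeight G p q B ω / rcPartitionFunction G p q B with hπ
  have hZ := rcPartitionFunction_pos G hp hq B
  have hπ0 : ∀ ω, 0 ≤ π ω := fun ω ↦ div_nonneg (rcWeight_nonneg G hp hq.le B ω) hZ.le
  -- indicators of the connection events on edge sets
  set ind : V → V → Finset (Sym2 V) → ℝ := fun u v ω ↦
    if (↑ω : BondConfig V) ∈ openConnIn Set.univ u v then 1 else 0 with hind
  have hind0 : ∀ u v ω, 0 ≤ ind u v ω := fun u v ω ↦ by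
    simp only [hind]; split_ifs <;> norm_num
  -- the weighted count `N_c` on edge sets
  set N : Finset (Sym2 V) → ℝ := fun ω ↦ ∑ u ∈ A, ∑ v ∈ C, c u v * ind u v ω with hN
  have hN0 : ∀ ω, 0 ≤ N ω := fun ω ↦
    Finset.sum_nonneg fun u _ ↦ Finset.sum_nonneg fun v _ ↦ mul_nonneg (hc u v) (hind0 u v ω)
  -- `φ[u ↔ v] = Σ_ω π ω ind`
  have hconn : ∀ u v, μ.real (openConnIn Set.univ u v) = ∑ ω ∈ P, π ω * ind u v ω := by
    intro u v
    rw [hμ, rcMeasure_real_apply G hp hq B]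
    refine Finset.sum_congr rfl fun ω _ ↦ ?_
    simp only [hind, hπ, mul_ite, mul_one, mul_zero]
  -- `φ[u ↔ v, u' ↔ v'] = Σ_ω π ω ind ind'`
  have hinter : ∀ u v u' v', μ.real (openConnIn Set.univ u v ∩ openConnIn Set.univ u' v') =
      ∑ ω ∈ P, π ω * (ind u v ω * ind u' v' ω) := by
    intro u v u' v'
    rw [hμ, rcMeasure_real_apply G hp hq B]
    refine Finset.sum_congr rfl fun ω _ ↦ ?_
    simp only [hind, hπ, Set.mem_inter_iff, mul_ite, mul_one, mul_zero]
    split_ifs <;> tauto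
  -- `φ[A ↔ C] = Σ_ω [ω ∈ A ↔ C] π ω`
  have hcross : μ.real (openCrossing Set.univ (↑A : Set V) ↑C) =
      ∑ ω ∈ P, if (↑ω : BondConfig V) ∈ openCrossing Set.univ (↑A : Set V) ↑C then π ω else 0 := by
    rw [hμ, rcMeasure_real_apply G hp hq B]
  -- first moment as a sum over configurations
  have hE1 : ∑ u ∈ A, ∑ v ∈ C, c u v * μ.real (openConnIn Set.univ u v) = ∑ ω ∈ P, π ω * N ω :=
    calc ∑ u ∈ A, ∑ v ∈ C, c u v * μ.real (openConnIn Set.univ u v)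
        = ∑ u ∈ A, ∑ v ∈ C, ∑ ω ∈ P, π ω * (c u v * ind u v ω) := by
          refine Finset.sum_congr rfl fun u _ ↦ Finset.sum_congr rfl fun v _ ↦ ?_
          rw [hconn, Finset.mul_sum]
          exact Finset.sum_congr rfl fun ω _ ↦ by ring
      _ = ∑ u ∈ A, ∑ ω ∈ P, ∑ v ∈ C, π ω * (c u v * ind u v ω) :=
          Finset.sum_congr rfl fun u _ ↦ Finset.sum_comm
      _ = ∑ ω ∈ P, ∑ u ∈ A, ∑ v ∈ C, π ω * (c u v * ind u v ω) := Finset.sum_comm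
      _ = ∑ ω ∈ P, π ω * N ω := by
          refine Finset.sum_congr rfl fun ω _ ↦ ?_
          simp only [hN, Finset.mul_sum]
  -- the square of `N` expanded
  have hsq : ∀ ω, N ω ^ 2 = ∑ u ∈ A, ∑ v ∈ C, ∑ u' ∈ A, ∑ v' ∈ C,
      c u v * c u' v' * (ind u v ω * ind u' v' ω) := by
    intro ω
    rw [sq]
    simp only [hN, Finset.sum_mul, Finset.mul_sum]
    exact Finset.sum_congr rfl fun u _ ↦ Finset.sum_congr rfl fun v _ ↦
      Finset.sum_congr rfl fun u' _ ↦ Finset.sum_congr rfl fun v' _ ↦ by ring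
  -- second moment as a sum over configurations
  have hE2 : ∑ u ∈ A, ∑ v ∈ C, ∑ u' ∈ A, ∑ v' ∈ C, c u v * c u' v' *
      μ.real (openConnIn Set.univ u v ∩ openConnIn Set.univ u' v') = ∑ ω ∈ P, π ω * N ω ^ 2 :=
    calc ∑ u ∈ A, ∑ v ∈ C, ∑ u' ∈ A, ∑ v' ∈ C, c u v * c u' v' *
          μ.real (openConnIn Set.univ u v ∩ openConnIn Set.univ u' v')
        = ∑ u ∈ A, ∑ v ∈ C, ∑ u' ∈ A, ∑ v' ∈ C, ∑ ω ∈ P,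
            π ω * (c u v * c u' v' * (ind u v ω * ind u' v' ω)) := by
          refine Finset.sum_congr rfl fun u _ ↦ Finset.sum_congr rfl fun v _ ↦
            Finset.sum_congr rfl fun u' _ ↦ Finset.sum_congr rfl fun v' _ ↦ ?_
          rw [hinter, Finset.mul_sum]
          exact Finset.sum_congr rfl fun ω _ ↦ by ring
      _ = ∑ u ∈ A, ∑ v ∈ C, ∑ u' ∈ A, ∑ ω ∈ P, ∑ v' ∈ C,
            π ω * (c u v * c u' v' * (ind u v ω * ind u' v' ω)) :=
          Finset.sum_congr rfl fun u _ ↦ Finset.sum_congr rfl fun v _ ↦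
            Finset.sum_congr rfl fun u' _ ↦ Finset.sum_comm
      _ = ∑ u ∈ A, ∑ v ∈ C, ∑ ω ∈ P, ∑ u' ∈ A, ∑ v' ∈ C,
            π ω * (c u v * c u' v' * (ind u v ω * ind u' v' ω)) :=
          Finset.sum_congr rfl fun u _ ↦ Finset.sum_congr rfl fun v _ ↦ Finset.sum_comm
      _ = ∑ u ∈ A, ∑ ω ∈ P, ∑ v ∈ C, ∑ u' ∈ A, ∑ v' ∈ C,
            π ω * (c u v * c u' v' * (ind u v ω * ind u' v' ω)) :=
          Finset.sum_congr rfl fun u _ ↦ Finset.sum_comm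
      _ = ∑ ω ∈ P, ∑ u ∈ A, ∑ v ∈ C, ∑ u' ∈ A, ∑ v' ∈ C,
            π ω * (c u v * c u' v' * (ind u v ω * ind u' v' ω)) := Finset.sum_comm
      _ = ∑ ω ∈ P, π ω * N ω ^ 2 := by
          refine Finset.sum_congr rfl fun ω _ ↦ ?_
          simp only [hsq, Finset.mul_sum]
  -- `N` vanishes off the crossing event
  have hNzero : ∀ ω : Finset (Sym2 V), (↑ω : BondConfig V) ∉ openCrossing Set.univ (↑A : Set V) ↑C →
      N ω = 0 := by
    intro ω hω
    refine Finset.sum_eq_zero fun u hu ↦ Finset.sum_eq_zero fun v hv ↦ ?_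
    have : (↑ω : BondConfig V) ∉ openConnIn Set.univ u v := fun h ↦
      hω (openConnIn_subset_openCrossing (Finset.mem_coe.2 hu) (Finset.mem_coe.2 hv) h)
    simp only [hind, if_neg this, mul_zero]
  -- Cauchy–Schwarz: `φ[N]² = φ[N 1_{A ↔ C}]² ≤ φ(A ↔ C) φ[N²]`
  rw [hE1, hE2, hcross]
  refine Finset.sum_sq_le_sum_mul_sum_of_sq_le_mul _ (fun ω _ ↦ ?_) (fun ω _ ↦ ?_) (fun ω _ ↦ ?_)
  · split_ifs
    · exact hπ0 ω
    · exact le_rfl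
  · exact mul_nonneg (hπ0 ω) (sq_nonneg _)
  · by_cases hω : (↑ω : BondConfig V) ∈ openCrossing Set.univ (↑A : Set V) ↑C
    · rw [if_pos hω]
      exact le_of_eq (by ring)
    · rw [if_neg hω, hNzero ω hω]
      simp

/-- **CDH16's choice of weights** `c_{uv} = φ[u ↔ v]` (eq. (4.1):
`N := Σ_{u ∈ (ab)} Σ_{v ∈ (cd)} φ[u ↔ v] 𝟙_{u ↔ v}`, so that `φ[N] = Σ φ[u ↔ v]²` and
`φ[N²] = Σ φ[u ↔ v] φ[u' ↔ v'] φ[u ↔ v, u' ↔ v']`): the crossing probability of any finite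
random-cluster measure satisfies
`(Σ_{u,v} φ[u ↔ v]²)² ≤ φ[A ↔ C] · Σ_{u,v,u',v'} φ[u ↔ v] φ[u' ↔ v'] φ[u ↔ v, u' ↔ v']`.
[cite: ChelkakDuminilCopinHongler2016, §4.1 eq. (4.1) and §4.3, proof of Thm. 1.1 (i)] -/
theorem rcMeasure_sq_sum_sq_openConnIn_le_openCrossing_mul {p q : ℝ} (hp : p ∈ Set.Icc (0 : ℝ) 1)
    (hq : 0 < q) (B : Set V) (A C : Finset V) :
    (∑ u ∈ A, ∑ v ∈ C, (rcMeasure G p q B).real (openConnIn Set.univ u v) ^ 2) ^ 2 ≤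
      (rcMeasure G p q B).real (openCrossing Set.univ (↑A : Set V) ↑C) *
        ∑ u ∈ A, ∑ v ∈ C, ∑ u' ∈ A, ∑ v' ∈ C,
          (rcMeasure G p q B).real (openConnIn Set.univ u v) *
            (rcMeasure G p q B).real (openConnIn Set.univ u' v') *
              (rcMeasure G p q B).real (openConnIn Set.univ u v ∩ openConnIn Set.univ u' v') := by
  have h := rcMeasure_sq_sum_openConnIn_le_openCrossing_mul G hp hq B A C
    (fun u v ↦ (rcMeasure G p q B).real (openConnIn Set.univ u v)) fun _ _ ↦ measureReal_nonneg
  simpa only [sq] using h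

/-- The second-moment step for **CDH16's measures** `φ^B_Ω = DiscreteRect.fkMeasure E B` (critical FK-Ising
measure of the discrete domain `⟨E⟩`, wired on `B`; CDH16 use it with `B = ∅`, §4.3): for any two finite
sets `A`, `C` of vertices of `Ω` (in the proof of Thm. 1.1 (i): the arcs `(ab)`, `(cd)`),
`(Σ_{u ∈ A, v ∈ C} φ[u ↔ v]²)² ≤ φ[A ↔ C] · Σ_{u,v,u',v'} φ[u ↔ v] φ[u' ↔ v'] φ[u ↔ v, u' ↔ v']`, i.e.
`φ[(ab) ↔ (cd)] ≥ φ[N]² / φ[N²]` for the weighted pair count `N` of (4.1).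
[cite: ChelkakDuminilCopinHongler2016, §4.1 eq. (4.1) and §4.3, proof of Thm. 1.1 (i)] -/
theorem DiscreteRect.fkMeasure_sq_sum_sq_openConnIn_le_openCrossing_mul (E : Finset (Sym2 (Site 2)))
    (B : Set ↥((DiscreteRect.verts E : Finset (Site 2)) : Set (Site 2)))
    (A C : Finset ↥((DiscreteRect.verts E : Finset (Site 2)) : Set (Site 2))) :
    (∑ u ∈ A, ∑ v ∈ C, (DiscreteRect.fkMeasure E B).real (openConnIn Set.univ u v) ^ 2) ^ 2 ≤
      (DiscreteRect.fkMeasure E B).real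
          (openCrossing Set.univ (↑A : Set ↥((DiscreteRect.verts E : Finset (Site 2)) : Set (Site 2))) ↑C) *
        ∑ u ∈ A, ∑ v ∈ C, ∑ u' ∈ A, ∑ v' ∈ C,
          (DiscreteRect.fkMeasure E B).real (openConnIn Set.univ u v) *
            (DiscreteRect.fkMeasure E B).real (openConnIn Set.univ u' v') *
              (DiscreteRect.fkMeasure E B).real (openConnIn Set.univ u v ∩ openConnIn Set.univ u' v') := by
  classical
  unfold DiscreteRect.fkMeasure
  convert rcMeasure_sq_sum_sq_openConnIn_le_openCrossing_mul (DiscreteRect.graph E)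
    criticalFKIsingParam_mem_Icc two_pos B A C using 3

end SecondMomentMethod

/-! ### Finiteness of CDH16's random-walk partition function `Z_Ω[x,y]` (§3.1)

`DiscreteRWPartitionFunction.lean` defines `Z_Ω[x,y] = Σ_γ w(γ)` (CDH16 display (3.1)) as an `ℝ≥0∞`-valued
sum over all walks of `DiscreteRect.graph E`. Here we prove it is finite for every domain drawn on the
lattice: summing by length, `Z_Ω[x,y] = Σ_n S_n(x,y)` with `S_{n+1}(x,y) = (T S_n(·,y))(x)` for the one-step
operator `(T f)(x) = m_x⁻¹ Σ_{u ∼ x} f(u)`; since `deg_x ≤ m_x` everywhere and `deg_x ≤ 3 < m_x (3 + w_ext)/3`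
at boundary vertices, the survival probabilities `T^n 1` are at most `1`, lose a factor `3/(3 + w_ext)` at the
boundary, and — every vertex being joined to the boundary by a path of fewer than `|Ω|` edges
(`exists_isExtDart_east`) — contract uniformly over blocks of `|Ω|` steps, so the series converges
geometrically. -/

section RWPartitionFunctionFinite

namespace DiscreteRect

open SimpleGraph Finset
open scoped ENNReal

variable {E : Finset (Sym2 (Site 2))}

/-- Adjacency in `DiscreteRect.graph E`. [folklore] -/
theorem graph_adj_iff {x y : ↥((verts E : Finset (Site 2)) : Set (Site 2))} : (graph E).Adj x y ↔ s(x.1, y.1) ∈ E ∧ x.1 ≠ y.1 := by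
  simp [graph, SimpleGraph.comap_adj, SimpleGraph.fromEdgeSet_adj]

/-- In a domain inside the lattice, a neighbour in `graph E` sits in one of the four lattice directions,
along an edge of `E`. [folklore] -/
theorem exists_eq_add_dir_of_graph_adj (hE : ∀ e ∈ E, e ∈ (zdGraph 2).edgeSet) {x y : ↥((verts E : Finset (Site 2)) : Set (Site 2))}
    (h : (graph E).Adj x y) : ∃ k : Fin 4, y.1 = x.1 + dir k ∧ s(x.1, x.1 + dir k) ∈ E := by
  obtain ⟨hmem, -⟩ := graph_adj_iff.1 h
  have hadj : (zdGraph 2).Adj x.1 y.1 := by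
    have := hE _ hmem
    rwa [SimpleGraph.mem_edgeSet] at this
  rw [zdGraph_adj_iff] at hadj
  obtain ⟨i, hi | hi⟩ := hadj
  · fin_cases i
    · refine ⟨0, ?_, ?_⟩
      · simpa [dir] using hi
      · rw [show x.1 + dir 0 = y.1 from by simpa [dir] using hi.symm]; exact hmem
    · refine ⟨1, ?_, ?_⟩
      · simpa [dir] using hi
      · rw [show x.1 + dir 1 = y.1 from by simpa [dir] using hi.symm]; exact hmem
  · fin_cases i
    · refine ⟨2, ?_, ?_⟩
      · rw [hi]; simp [dir]
      · rw [show x.1 + dir 2 = y.1 from by rw [hi]; simp [dir]]; exact hmem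
    · refine ⟨3, ?_, ?_⟩
      · rw [hi]; simp [dir]
      · rw [show x.1 + dir 3 = y.1 from by rw [hi]; simp [dir]]; exact hmem

/-! #### The one-step operator of CDH16's random walk and the finiteness of `Z_Ω` -/

open scoped Classical in
/-- One step of CDH16's random walk acting on functions on `Ω`: `(T f)(x) = m_x⁻¹ Σ_{u ∼ x} f(u)` (the
sub-Markov kernel of the walk on `Ω̄` killed on `∂_ext Ω`, restricted to `Ω`). Auxiliary for the finiteness of
the partition function. [cite: ChelkakDuminilCopinHongler2016, §3.1] -/
def stepOp (E : Finset (Sym2 (Site 2))) (f : ↥((verts E : Finset (Site 2)) : Set (Site 2)) → ℝ) (x : ↥((verts E : Finset (Site 2)) : Set (Site 2))) : ℝ :=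
  (mass E x.1)⁻¹ * ∑ u ∈ (graph E).neighborFinset x, f u

open scoped Classical

/-- `T` is monotone. [folklore] -/
theorem stepOp_mono {f g : ↥((verts E : Finset (Site 2)) : Set (Site 2)) → ℝ} (h : f ≤ g) : stepOp E f ≤ stepOp E g := fun x =>
  mul_le_mul_of_nonneg_left (Finset.sum_le_sum fun u _ => h u) (inv_nonneg.2 (mass_pos E x.1).le)

/-- `T` preserves nonnegativity. [folklore] -/
theorem stepOp_nonneg {f : ↥((verts E : Finset (Site 2)) : Set (Site 2)) → ℝ} (h : 0 ≤ f) : 0 ≤ stepOp E f := fun x =>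
  mul_nonneg (inv_nonneg.2 (mass_pos E x.1).le) (Finset.sum_nonneg fun u _ => h u)

/-- `T` commutes with scalars. [folklore] -/
theorem stepOp_smul (c : ℝ) (f : ↥((verts E : Finset (Site 2)) : Set (Site 2)) → ℝ) : stepOp E (fun u => c * f u) = fun x => c * stepOp E f x := by
  funext x
  simp only [stepOp, ← Finset.mul_sum]
  ring

/-- The iterates of `T` are monotone. [folklore] -/
theorem stepOp_iterate_mono (n : ℕ) : Monotone (fun f : ↥((verts E : Finset (Site 2)) : Set (Site 2)) → ℝ => (stepOp E)^[n] f) :=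
  Monotone.iterate (fun _ _ h => stepOp_mono h) n

/-- The iterates of `T` commute with scalars. [folklore] -/
theorem stepOp_iterate_smul (c : ℝ) (f : ↥((verts E : Finset (Site 2)) : Set (Site 2)) → ℝ) (n : ℕ) :
    (stepOp E)^[n] (fun u => c * f u) = fun x => c * (stepOp E)^[n] f x := by
  induction n generalizing f with
  | zero => rfl
  | succ n ih =>
    rw [Function.iterate_succ_apply, Function.iterate_succ_apply, stepOp_smul, ih]

/-- The number of neighbours of `x` in `graph E` is at most the number of lattice directions at `x` occupied by
an edge of `E` (each neighbour sits in its own direction). [folklore] -/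
theorem card_neighborFinset_le (hE : ∀ e ∈ E, e ∈ (zdGraph 2).edgeSet) (x : ↥((verts E : Finset (Site 2)) : Set (Site 2))) :
    #((graph E).neighborFinset x) ≤ #({k : Fin 4 | s(x.1, x.1 + dir k) ∈ E} : Finset (Fin 4)) := by
  let φ : ↥((verts E : Finset (Site 2)) : Set (Site 2)) → Fin 4 := fun u =>
    if h : (graph E).Adj x u then Classical.choose (exists_eq_add_dir_of_graph_adj hE h) else 0
  refine Finset.card_le_card_of_injOn φ ?_ ?_
  · intro u hu
    have hu' : (graph E).Adj x u := by simpa [mem_neighborFinset] using hu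
    have := (Classical.choose_spec (exists_eq_add_dir_of_graph_adj hE hu')).2
    simpa [φ, dif_pos hu'] using this
  · intro u hu v hv huv
    have hu' : (graph E).Adj x u := by simpa [mem_neighborFinset] using hu
    have hv' : (graph E).Adj x v := by simpa [mem_neighborFinset] using hv
    have h1 := (Classical.choose_spec (exists_eq_add_dir_of_graph_adj hE hu')).1
    have h2 := (Classical.choose_spec (exists_eq_add_dir_of_graph_adj hE hv')).1
    have hφ : φ u = φ v := huv
    simp only [φ, dif_pos hu', dif_pos hv'] at hφ
    apply Subtype.ext
    rw [h1, h2, hφ]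

/-- `deg_x ≤ m_x`: every edge of `E` at `x` contributes `1` to the mass. [cite: ChelkakDuminilCopinHongler2016, §3.1] -/
theorem card_neighborFinset_le_mass (hE : ∀ e ∈ E, e ∈ (zdGraph 2).edgeSet) (x : ↥((verts E : Finset (Site 2)) : Set (Site 2))) :
    (#((graph E).neighborFinset x) : ℝ) ≤ mass E x.1 := by
  have h1 : (#((graph E).neighborFinset x) : ℝ) ≤
      (#({k : Fin 4 | s(x.1, x.1 + dir k) ∈ E} : Finset (Fin 4)) : ℝ) := by
    exact_mod_cast card_neighborFinset_le hE x
  have h4 : (#({k : Fin 4 | s(x.1, x.1 + dir k) ∈ E} : Finset (Fin 4)) : ℝ) ≤ 4 := by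
    have := Finset.card_le_univ ({k : Fin 4 | s(x.1, x.1 + dir k) ∈ E} : Finset (Fin 4))
    simp only [Fintype.card_fin] at this
    exact_mod_cast this
  rw [mass_eq_card_filter]
  have hw := wExt_pos
  have hw1 := wExt_lt_one
  nlinarith

/-- `(T 1)(x) = deg_x / m_x ≤ 1`. [cite: ChelkakDuminilCopinHongler2016, §3.1] -/
theorem stepOp_one_le (hE : ∀ e ∈ E, e ∈ (zdGraph 2).edgeSet) (x : ↥((verts E : Finset (Site 2)) : Set (Site 2))) :
    stepOp E (fun _ => (1 : ℝ)) x ≤ 1 := by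
  unfold stepOp
  rw [Finset.sum_const, nsmul_eq_mul, mul_one]
  rw [inv_mul_le_iff₀ (mass_pos E x.1), mul_one]
  exact card_neighborFinset_le_mass hE x

/-- At a boundary vertex (one carrying an external dart) the walk is killed with probability at least
`w_ext/(3 + w_ext)`: `(T 1)(x) ≤ 3/(3 + w_ext)`. [cite: ChelkakDuminilCopinHongler2016, §3.1] -/
theorem stepOp_one_le_of_isExtDart (hE : ∀ e ∈ E, e ∈ (zdGraph 2).edgeSet)
    {x : ↥((verts E : Finset (Site 2)) : Set (Site 2))} {k : Fin 4}
    (hx : IsExtDart E (x.1, k)) : stepOp E (fun _ => (1 : ℝ)) x ≤ 3 / (3 + wExt) := by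
  unfold stepOp
  rw [Finset.sum_const, nsmul_eq_mul, mul_one]
  have hw := wExt_pos
  have hw1 := wExt_lt_one
  have h1 : (#((graph E).neighborFinset x) : ℝ) ≤
      (#({k : Fin 4 | s(x.1, x.1 + dir k) ∈ E} : Finset (Fin 4)) : ℝ) := by
    exact_mod_cast card_neighborFinset_le hE x
  have h3 : (#({k : Fin 4 | s(x.1, x.1 + dir k) ∈ E} : Finset (Fin 4)) : ℝ) ≤ 3 := by
    have hsub : ({k : Fin 4 | s(x.1, x.1 + dir k) ∈ E} : Finset (Fin 4)) ⊆ Finset.univ.erase k := by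
      intro j hj
      simp only [Finset.mem_filter, Finset.mem_univ, true_and] at hj
      rw [Finset.mem_erase]
      refine ⟨?_, Finset.mem_univ _⟩
      rintro rfl
      exact hx.2 hj
    have := Finset.card_le_card hsub
    rw [Finset.card_erase_of_mem (Finset.mem_univ _), Finset.card_univ, Fintype.card_fin] at this
    have h' : (#({k : Fin 4 | s(x.1, x.1 + dir k) ∈ E} : Finset (Fin 4)) : ℝ) ≤ ((4 - 1 : ℕ) : ℝ) := by
      exact_mod_cast this
    norm_num at h'
    exact_mod_cast h'
  have hm : mass E x.1 = 4 * wExt + (1 - wExt) * #({k : Fin 4 | s(x.1, x.1 + dir k) ∈ E} : Finset (Fin 4)) :=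
    mass_eq_card_filter E x.1
  rw [hm, inv_mul_le_iff₀ (by nlinarith)]
  refine h1.trans ?_
  rw [mul_div_assoc', le_div_iff₀ (by linarith)]
  nlinarith [mul_le_mul_of_nonneg_left h3 hw.le]

/-- Iterates of `T` on the constant `1` stay in `[0, 1]`. [folklore] -/
theorem stepOp_iterate_one_mem (hE : ∀ e ∈ E, e ∈ (zdGraph 2).edgeSet) (n : ℕ) (x : ↥((verts E : Finset (Site 2)) : Set (Site 2))) :
    0 ≤ (stepOp E)^[n] (fun _ => (1 : ℝ)) x ∧ (stepOp E)^[n] (fun _ => (1 : ℝ)) x ≤ 1 := by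
  induction n generalizing x with
  | zero => simp
  | succ n ih =>
    rw [Function.iterate_succ_apply']
    refine ⟨stepOp_nonneg (fun u => (ih u).1) x, ?_⟩
    exact (stepOp_mono (f := (stepOp E)^[n] fun _ => (1 : ℝ)) (g := fun _ => (1 : ℝ)) (fun u => (ih u).2) x).trans
      (stepOp_one_le hE x)

/-- Iterates of `T` on `1` decrease. [folklore] -/
theorem stepOp_iterate_one_antitone (hE : ∀ e ∈ E, e ∈ (zdGraph 2).edgeSet) (x : ↥((verts E : Finset (Site 2)) : Set (Site 2))) :
    Antitone fun n => (stepOp E)^[n] (fun _ => (1 : ℝ)) x := by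
  refine antitone_nat_of_succ_le fun n => ?_
  show (stepOp E)^[n + 1] (fun _ => (1 : ℝ)) x ≤ (stepOp E)^[n] (fun _ => (1 : ℝ)) x
  rw [Function.iterate_succ_apply]
  exact stepOp_iterate_mono n (fun u => stepOp_one_le hE u) x

/-- **Decay along a walk to the boundary**: if `x` is joined to a boundary vertex `b` by a walk of length `d`,
then the walk started at `x` dies within `d + 1` steps with probability at least `ε 4^{-d}`,
`ε = w_ext/(3 + w_ext)`: `(T^{d+1} 1)(x) ≤ 1 - ε 4^{-d}`. [folklore] -/
theorem stepOp_iterate_one_le_of_walk (hE : ∀ e ∈ E, e ∈ (zdGraph 2).edgeSet) {b : ↥((verts E : Finset (Site 2)) : Set (Site 2))} {k : Fin 4}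
    (hb : IsExtDart E (b.1, k)) {x : ↥((verts E : Finset (Site 2)) : Set (Site 2))} (p : (graph E).Walk x b) :
    (stepOp E)^[p.length + 1] (fun _ => (1 : ℝ)) x ≤ 1 - (1 - 3 / (3 + wExt)) * (4⁻¹ : ℝ) ^ p.length := by
  induction p with
  | nil =>
    simp only [Walk.length_nil, zero_add, Function.iterate_one, pow_zero, mul_one]
    have := stepOp_one_le_of_isExtDart hE hb
    linarith
  | @cons u v w huv q ih =>
    have ih' := ih hb
    rw [Walk.length_cons, Function.iterate_succ_apply']
    set g : ↥((verts E : Finset (Site 2)) : Set (Site 2)) → ℝ := (stepOp E)^[q.length + 1] fun _ => (1 : ℝ) with hg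
    have hg1 : ∀ z, g z ≤ 1 := fun z => (stepOp_iterate_one_mem hE _ z).2
    have hv : v ∈ (graph E).neighborFinset u := by simpa [mem_neighborFinset] using huv
    -- `Σ_{z ∼ u} g z ≤ (deg u - 1) + g v ≤ deg u - ε 4^{-l}`
    have hsum : ∑ z ∈ (graph E).neighborFinset u, g z ≤
        #((graph E).neighborFinset u) - (1 - 3 / (3 + wExt)) * (4⁻¹ : ℝ) ^ q.length := by
      rw [← Finset.add_sum_erase _ _ hv]
      have h2 : ∑ z ∈ ((graph E).neighborFinset u).erase v, g z ≤ (#((graph E).neighborFinset u) - 1 : ℝ) := by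
        calc ∑ z ∈ ((graph E).neighborFinset u).erase v, g z
            ≤ ∑ _z ∈ ((graph E).neighborFinset u).erase v, (1 : ℝ) := Finset.sum_le_sum fun z _ => hg1 z
          _ = #(((graph E).neighborFinset u).erase v) := by simp
          _ = (#((graph E).neighborFinset u) - 1 : ℝ) := by
              rw [Finset.card_erase_of_mem hv, Nat.cast_sub (Finset.card_pos.2 ⟨v, hv⟩)]
              simp
      linarith
    have hm4 := mass_le_four E u.1
    have hmpos := mass_pos E u.1
    have hdeg := card_neighborFinset_le_mass hE u
    have hw := wExt_pos
    have hε : 0 ≤ (1 - 3 / (3 + wExt)) * (4⁻¹ : ℝ) ^ q.length := by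
      apply mul_nonneg
      · rw [sub_nonneg, div_le_one (by linarith)]; linarith
      · positivity
    show (mass E u.1)⁻¹ * ∑ z ∈ (graph E).neighborFinset u, g z ≤ 1 - (1 - 3 / (3 + wExt)) * 4⁻¹ ^ (q.length + 1)
    rw [inv_mul_le_iff₀ hmpos]
    calc ∑ z ∈ (graph E).neighborFinset u, g z
        ≤ #((graph E).neighborFinset u) - (1 - 3 / (3 + wExt)) * (4⁻¹ : ℝ) ^ q.length := hsum
      _ ≤ mass E u.1 - (1 - 3 / (3 + wExt)) * (4⁻¹ : ℝ) ^ q.length := by linarith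
      _ ≤ mass E u.1 * (1 - (1 - 3 / (3 + wExt)) * 4⁻¹ ^ (q.length + 1)) := by
          rw [pow_succ, mul_sub, mul_one]
          nlinarith

/-- **Uniform killing**: with `N = |Ω|`, `(T^N 1)(x) ≤ θ := 1 - ε 4^{-(N-1)} < 1` for every vertex `x` of a
lattice domain (every vertex is joined to the boundary by a path of fewer than `N` edges,
`exists_isExtDart_east`). [folklore] -/
theorem stepOp_iterate_card_one_le (hE : ∀ e ∈ E, e ∈ (zdGraph 2).edgeSet) (x : ↥((verts E : Finset (Site 2)) : Set (Site 2))) :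
    (stepOp E)^[Fintype.card ↥((verts E : Finset (Site 2)) : Set (Site 2))] (fun _ => (1 : ℝ)) x ≤
      1 - (1 - 3 / (3 + wExt)) * (4⁻¹ : ℝ) ^ (Fintype.card ↥((verts E : Finset (Site 2)) : Set (Site 2)) - 1) := by
  obtain ⟨t, hb, hreach⟩ := exists_isExtDart_east (E := E) x.2
  obtain ⟨p⟩ := hreach
  have hbV : x.1 + (t : ℤ) • dir 0 ∈ verts E := hb.1
  obtain ⟨q⟩ : (graph E).Reachable x ⟨x.1 + (t : ℤ) • dir 0, hbV⟩ := graph_reachable_of_walk p x.2 hbV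
  let r := q.toPath
  have hlen : (r : (graph E).Walk x ⟨_, hbV⟩).length < Fintype.card ↥((verts E : Finset (Site 2)) : Set (Site 2)) := r.2.length_lt
  have h1 := stepOp_iterate_one_le_of_walk hE (b := ⟨_, hbV⟩) hb (r : (graph E).Walk x ⟨_, hbV⟩)
  have h2 : (stepOp E)^[Fintype.card ↥((verts E : Finset (Site 2)) : Set (Site 2))] (fun _ => (1 : ℝ)) x ≤
      (stepOp E)^[(r : (graph E).Walk x ⟨_, hbV⟩).length + 1] (fun _ => (1 : ℝ)) x :=
    stepOp_iterate_one_antitone hE x (by omega)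
  refine h2.trans (h1.trans ?_)
  have hw := wExt_pos
  have hε : 0 ≤ (1 - 3 / (3 + wExt)) := by
    rw [sub_nonneg, div_le_one (by linarith)]; linarith
  have hpow : (4⁻¹ : ℝ) ^ (Fintype.card ↥((verts E : Finset (Site 2)) : Set (Site 2)) - 1) ≤ (4⁻¹ : ℝ) ^ (r : (graph E).Walk x ⟨_, hbV⟩).length :=
    pow_le_pow_of_le_one (by norm_num) (by norm_num) (by omega)
  nlinarith

/-- Geometric decay of the survival probabilities: `(T^n 1)(x) ≤ θ^{⌊n/N⌋}`. [folklore] -/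
theorem stepOp_iterate_one_le_pow (hE : ∀ e ∈ E, e ∈ (zdGraph 2).edgeSet) (n : ℕ) (x : ↥((verts E : Finset (Site 2)) : Set (Site 2))) :
    (stepOp E)^[n] (fun _ => (1 : ℝ)) x ≤
      (1 - (1 - 3 / (3 + wExt)) * (4⁻¹ : ℝ) ^ (Fintype.card ↥((verts E : Finset (Site 2)) : Set (Site 2)) - 1)) ^ (n / Fintype.card ↥((verts E : Finset (Site 2)) : Set (Site 2))) := by
  set N := Fintype.card ↥((verts E : Finset (Site 2)) : Set (Site 2)) with hN
  set θ : ℝ := 1 - (1 - 3 / (3 + wExt)) * (4⁻¹ : ℝ) ^ (N - 1) with hθ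
  have hθ0 : 0 ≤ θ := by
    have hw := wExt_pos
    have h1 : (1 - 3 / (3 + wExt)) ≤ 1 := by
      have : 0 ≤ 3 / (3 + wExt) := by positivity
      linarith
    have h2 : (4⁻¹ : ℝ) ^ (N - 1) ≤ 1 := pow_le_one₀ (by norm_num) (by norm_num)
    have hε : 0 ≤ (1 - 3 / (3 + wExt)) := by
      rw [sub_nonneg, div_le_one (by linarith)]; linarith
    rw [hθ]; nlinarith
  -- blocks of `N` steps contract by `θ`
  have hblock : ∀ k : ℕ, ∀ z : ↥((verts E : Finset (Site 2)) : Set (Site 2)), (stepOp E)^[N * k] (fun _ => (1 : ℝ)) z ≤ θ ^ k := by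
    intro k
    induction k with
    | zero => intro z; simp
    | succ k ih =>
      intro z
      rw [Nat.mul_succ, Function.iterate_add_apply]
      have hle : (stepOp E)^[N] (fun _ => (1 : ℝ)) ≤ fun _ => θ * 1 := fun y => by
        rw [mul_one]; exact stepOp_iterate_card_one_le hE y
      calc (stepOp E)^[N * k] ((stepOp E)^[N] fun _ => (1 : ℝ)) z
          ≤ (stepOp E)^[N * k] (fun _ => θ * 1) z := stepOp_iterate_mono (N * k) hle z
        _ = θ * (stepOp E)^[N * k] (fun _ => (1 : ℝ)) z := by rw [stepOp_iterate_smul]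
        _ ≤ θ * θ ^ k := mul_le_mul_of_nonneg_left (ih z) hθ0
        _ = θ ^ (k + 1) := by ring
  -- general `n = N (n / N) + n % N`
  conv_lhs => rw [← Nat.div_add_mod' n N, Nat.mul_comm, Nat.add_comm, Function.iterate_add_apply]
  calc (stepOp E)^[n % N] ((stepOp E)^[N * (n / N)] fun _ => (1 : ℝ)) x
      ≤ (stepOp E)^[n % N] (fun _ => θ ^ (n / N) * 1) x :=
        stepOp_iterate_mono (n % N) (fun z => by rw [mul_one]; exact hblock (n / N) z) x
    _ = θ ^ (n / N) * (stepOp E)^[n % N] (fun _ => (1 : ℝ)) x := by rw [stepOp_iterate_smul]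
    _ ≤ θ ^ (n / N) * 1 := mul_le_mul_of_nonneg_left (stepOp_iterate_one_mem hE _ x).2 (pow_nonneg hθ0 _)
    _ = θ ^ (n / N) := mul_one _


/-! #### Level sums of the partition function by walk length -/

/-- **One-step recursion of the level sums** of `Z_Ω[x,y]`: the paths of length `n + 1` from `x` are the
one-step extensions of the paths of length `n` from its neighbours, so
`Σ_{|γ| = n+1, γ : x → y} w(γ) = (T Σ_{|γ'| = n, γ' : · → y} w(γ'))(x)`. [cite: ChelkakDuminilCopinHongler2016, §3.1] -/
theorem sum_walkWeight_finsetWalkLength_succ (n : ℕ) (x y : ↥((verts E : Finset (Site 2)) : Set (Site 2))) :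
    ∑ p ∈ (graph E).finsetWalkLength (n + 1) x y, walkWeight E p =
      stepOp E (fun u => ∑ q ∈ (graph E).finsetWalkLength n u y, walkWeight E q) x := by
  rw [finsetWalkLength, Finset.sum_biUnion]
  · simp only [Finset.sum_map, Function.Embedding.coeFn_mk, walkWeight_cons]
    unfold stepOp
    simp only [← Finset.mul_sum]
    congr 1
    exact (Finset.sum_subtype ((graph E).neighborFinset x) (fun u => by simp [mem_neighborFinset])
      (fun u => ∑ q ∈ (graph E).finsetWalkLength n u y, walkWeight E q)).symm
  · intro w₁ _ w₂ _ hne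
    simp only [Function.onFun]
    rw [Finset.disjoint_left]
    intro p hp₁ hp₂
    rw [Finset.mem_map] at hp₁ hp₂
    obtain ⟨q₁, -, rfl⟩ := hp₁
    obtain ⟨q₂, -, h⟩ := hp₂
    apply hne
    apply Subtype.ext
    have := congrArg (fun p : (graph E).Walk x y => p.getVert (0 + 1)) h
    simp only [Function.Embedding.coeFn_mk, Walk.getVert_cons_succ, Walk.getVert_zero] at this
    exact this.symm

/-- The level `0`: only the trivial path, of weight `m_x⁻¹ ≤ (4 w_ext)⁻¹`. [cite: ChelkakDuminilCopinHongler2016, §3.1] -/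
theorem sum_walkWeight_finsetWalkLength_zero_le (x y : ↥((verts E : Finset (Site 2)) : Set (Site 2))) :
    ∑ p ∈ (graph E).finsetWalkLength 0 x y, walkWeight E p ≤ (4 * wExt)⁻¹ := by
  have hw := wExt_pos
  by_cases hxy : x = y
  · subst hxy
    have h1 : (graph E).finsetWalkLength 0 x x = {Walk.nil} := by
      ext p
      rw [mem_finsetWalkLength_iff, Finset.mem_singleton]
      exact Walk.length_eq_zero_iff.trans Walk.eq_nil_iff_nil.symm
    rw [h1, Finset.sum_singleton, walkWeight_nil]
    exact inv_anti₀ (by positivity) (four_mul_wExt_le_mass E x.1)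
  · have h1 : (graph E).finsetWalkLength 0 x y = ∅ := by
      ext p
      simp only [mem_finsetWalkLength_iff, Finset.notMem_empty, iff_false]
      intro h
      exact hxy (Walk.eq_of_length_eq_zero h)
    rw [h1, Finset.sum_empty]
    positivity

/-- **Level sums are dominated by survival probabilities**:
`Σ_{|γ| = n, γ : x → y} w(γ) ≤ (4 w_ext)⁻¹ (T^n 1)(x)`. [cite: ChelkakDuminilCopinHongler2016, §3.1] -/
theorem sum_walkWeight_finsetWalkLength_le (n : ℕ) (x y : ↥((verts E : Finset (Site 2)) : Set (Site 2))) :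
    ∑ p ∈ (graph E).finsetWalkLength n x y, walkWeight E p ≤
      (4 * wExt)⁻¹ * (stepOp E)^[n] (fun _ => (1 : ℝ)) x := by
  induction n generalizing x with
  | zero => simpa using sum_walkWeight_finsetWalkLength_zero_le x y
  | succ n ih =>
    rw [sum_walkWeight_finsetWalkLength_succ, Function.iterate_succ_apply']
    calc stepOp E (fun u => ∑ q ∈ (graph E).finsetWalkLength n u y, walkWeight E q) x
        ≤ stepOp E (fun u => (4 * wExt)⁻¹ * (stepOp E)^[n] (fun _ => (1 : ℝ)) u) x :=
          stepOp_mono (fun u => ih u) x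
      _ = (4 * wExt)⁻¹ * stepOp E ((stepOp E)^[n] fun _ => (1 : ℝ)) x := by rw [stepOp_smul]

/-- **`Z_Ω[x,y]` summed by path length**: `Z_Ω[x,y] = Σ_n Σ_{|γ| = n} w(γ)`. [cite: ChelkakDuminilCopinHongler2016, §3.1] -/
theorem rwZ_eq_tsum_sum (x y : ↥((verts E : Finset (Site 2)) : Set (Site 2))) :
    rwZ E x y = ∑' n : ℕ, ENNReal.ofReal (∑ p ∈ (graph E).finsetWalkLength n x y, walkWeight E p) := by
  unfold rwZ
  have h1 : ∀ p : (graph E).Walk x y, ENNReal.ofReal (walkWeight E p) =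
      ∑' n : ℕ, if n = p.length then ENNReal.ofReal (walkWeight E p) else 0 := fun p => by
    rw [tsum_ite_eq]
  rw [tsum_congr h1, ENNReal.tsum_comm]
  refine tsum_congr fun n => ?_
  rw [ENNReal.ofReal_sum_of_nonneg (fun p _ => (walkWeight_pos p).le)]
  rw [tsum_eq_sum (s := (graph E).finsetWalkLength n x y) ?_]
  · refine Finset.sum_congr rfl fun p hp => ?_
    rw [mem_finsetWalkLength_iff] at hp
    rw [if_pos hp.symm]
  · intro p hp
    rw [mem_finsetWalkLength_iff] at hp
    rw [if_neg (Ne.symm hp)]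

/-- `Σ_n r^{⌊n/N⌋} ≤ N/(1-r) < ∞` for `r < 1`, `N ≥ 1`. [folklore] -/
theorem tsum_pow_div_lt_top {N : ℕ} (hN : 0 < N) {r : ℝ≥0∞} (hr : r < 1) :
    ∑' n : ℕ, r ^ (n / N) < ⊤ := by
  have hgeo : ∑' k : ℕ, r ^ k = (1 - r)⁻¹ := ENNReal.tsum_geometric r
  have hfin : (N : ℝ≥0∞) * (1 - r)⁻¹ < ⊤ :=
    ENNReal.mul_lt_top (by simp) (ENNReal.inv_lt_top.2 (tsub_pos_of_lt hr))
  refine lt_of_le_of_lt ?_ hfin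
  have hblock : ∀ i : ℕ, ∑ n ∈ Finset.range (N * i), r ^ (n / N) = ∑ k ∈ Finset.range i, (N : ℝ≥0∞) * r ^ k := by
    intro i
    induction i with
    | zero => simp
    | succ i ih =>
      rw [Nat.mul_succ, Finset.sum_range_add, ih, Finset.sum_range_succ]
      congr 1
      rw [Finset.sum_congr rfl fun j hj => by
        rw [Nat.mul_add_div hN, Nat.div_eq_of_lt (Finset.mem_range.1 hj), add_zero]]
      simp
  rw [ENNReal.tsum_eq_iSup_nat]
  refine iSup_le fun i => ?_
  calc ∑ n ∈ Finset.range i, r ^ (n / N) ≤ ∑ n ∈ Finset.range (N * i), r ^ (n / N) :=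
        Finset.sum_le_sum_of_subset (Finset.range_mono (Nat.le_mul_of_pos_left i hN))
    _ = ∑ k ∈ Finset.range i, (N : ℝ≥0∞) * r ^ k := hblock i
    _ = N * ∑ k ∈ Finset.range i, r ^ k := by rw [Finset.mul_sum]
    _ ≤ N * ∑' k, r ^ k := by gcongr; exact ENNReal.sum_le_tsum _
    _ = N * (1 - r)⁻¹ := by rw [hgeo]

/-- **The partition function is finite**: `Z_Ω[x,y] < ∞` for every discrete domain of the lattice and all
vertices `x, y` — the random walk of CDH16 §3.1 is killed (it reaches the boundary within `|Ω|` steps with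
probability bounded below, and is killed there with probability at least `w_ext/(3 + w_ext)`), so the path
sum `Σ_γ w(γ)` (= `m_y⁻¹ ×` the Green function of the killed walk) converges geometrically.
[cite: ChelkakDuminilCopinHongler2016, §3.1; Chelkak2016, §2.3] -/
theorem rwZ_lt_top (hE : ∀ e ∈ E, e ∈ (zdGraph 2).edgeSet) (x y : ↥((verts E : Finset (Site 2)) : Set (Site 2))) : rwZ E x y < ⊤ := by
  set N := Fintype.card ↥((verts E : Finset (Site 2)) : Set (Site 2)) with hN
  set θ : ℝ := 1 - (1 - 3 / (3 + wExt)) * (4⁻¹ : ℝ) ^ (N - 1) with hθ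
  have hN0 : 0 < N := Fintype.card_pos_iff.2 ⟨x⟩
  have hw := wExt_pos
  have hε : 0 < 1 - 3 / (3 + wExt) := by
    rw [sub_pos, div_lt_one (by linarith)]; linarith
  have hθ0 : 0 ≤ θ := by
    have h1 : (1 - 3 / (3 + wExt)) ≤ 1 := by
      have : 0 ≤ 3 / (3 + wExt) := by positivity
      linarith
    have h2 : (4⁻¹ : ℝ) ^ (N - 1) ≤ 1 := pow_le_one₀ (by norm_num) (by norm_num)
    rw [hθ]; nlinarith
  have hθ1 : θ < 1 := by
    have : 0 < (1 - 3 / (3 + wExt)) * (4⁻¹ : ℝ) ^ (N - 1) := by positivity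
    rw [hθ]; linarith
  rw [rwZ_eq_tsum_sum]
  have hterm : ∀ n : ℕ, ENNReal.ofReal (∑ p ∈ (graph E).finsetWalkLength n x y, walkWeight E p) ≤
      ENNReal.ofReal ((4 * wExt)⁻¹) * ENNReal.ofReal θ ^ (n / N) := by
    intro n
    calc ENNReal.ofReal (∑ p ∈ (graph E).finsetWalkLength n x y, walkWeight E p)
        ≤ ENNReal.ofReal ((4 * wExt)⁻¹ * θ ^ (n / N)) :=
          ENNReal.ofReal_le_ofReal ((sum_walkWeight_finsetWalkLength_le n x y).trans
            (mul_le_mul_of_nonneg_left (stepOp_iterate_one_le_pow hE n x) (by positivity)))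
      _ = ENNReal.ofReal ((4 * wExt)⁻¹) * ENNReal.ofReal θ ^ (n / N) := by
          rw [ENNReal.ofReal_mul (by positivity), ENNReal.ofReal_pow hθ0]
  calc ∑' n : ℕ, ENNReal.ofReal (∑ p ∈ (graph E).finsetWalkLength n x y, walkWeight E p)
      ≤ ∑' n : ℕ, ENNReal.ofReal ((4 * wExt)⁻¹) * ENNReal.ofReal θ ^ (n / N) := ENNReal.tsum_le_tsum hterm
    _ = ENNReal.ofReal ((4 * wExt)⁻¹) * ∑' n : ℕ, ENNReal.ofReal θ ^ (n / N) := ENNReal.tsum_mul_left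
    _ < ⊤ := ENNReal.mul_lt_top ENNReal.ofReal_lt_top
        (tsum_pow_div_lt_top hN0 (ENNReal.ofReal_lt_one.2 hθ1))

/-- `Z_Ω[x,y] ≠ ∞`. [cite: ChelkakDuminilCopinHongler2016, §3.1] -/
theorem rwZ_ne_top (hE : ∀ e ∈ E, e ∈ (zdGraph 2).edgeSet) (x y : ↥((verts E : Finset (Site 2)) : Set (Site 2))) : rwZ E x y ≠ ⊤ :=
  (rwZ_lt_top hE x y).ne

/-- **`Z_Ω[X,Y] < ∞`** for any two sets of vertices of a lattice domain (a finite double sum of finite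
terms). [cite: ChelkakDuminilCopinHongler2016, §3.1] -/
theorem rwZSets_lt_top (hE : ∀ e ∈ E, e ∈ (zdGraph 2).edgeSet) (X Y : Set ↥((verts E : Finset (Site 2)) : Set (Site 2))) : rwZSets E X Y < ⊤ := by
  classical
  rw [rwZSets_eq_sum]
  refine ENNReal.sum_lt_top.2 fun x _ => ENNReal.sum_lt_top.2 fun y _ => rwZ_lt_top hE x y

/-- In particular for a discrete topological rectangle: `Z_Ω[(ab),(cd)] < ∞`.
[cite: ChelkakDuminilCopinHongler2016, §3.1] -/
theorem IsRect.rwZSets_arcVerts_lt_top {d₀ : Site 2 × Fin 4} {n : Fin 4 → ℕ} (h : IsRect E d₀ n) (j j' : Fin 4) :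
    rwZSets E {x | x.1 ∈ arcVerts E d₀ n j} {x | x.1 ∈ arcVerts E d₀ n j'} < ⊤ :=
  rwZSets_lt_top h.subset_edgeSet _ _

end DiscreteRect

end RWPartitionFunctionFinite

end Literature.Probability.LatticeModels

end
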